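import Literature.NumberTheory.Automorphic.TwistedQuotientConeDescentRows
import HarnessLib

/-!
# The staircase on a convex cone, III: the descent step and the descent theorem

Topic `NumberTheory/Automorphic`; namespace `Literature.NumberTheory.Automorphic.TwistedQuotient`.
Sequel of `TwistedQuotientConeDescent` (definitions) and `TwistedQuotientConeDescentRows` (row
identities).  Theorems only (no definition, no named fact, no `sorry`).

* `delta_sub`, `famD_sub_apply`, `cochD_delta_apply` (`dδ = δd` at smooth points), `cochD_delta_zero`;
* equivariance ON `X` is preserved by `δ`, differences, `S_ψ`, `d` (`isEquivariantOn_delta/sub/cochS/cochD`);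
  smoothness on `X` is preserved by `δ`, differences, `d`, `T_ψ` (`smoothOn_delta/sub/cochD/cochT`);
  `cochD_cochT_apply` — `d T_ψ(λ, κ) = 0` on `X` (`= dd S_ψ λ`);
* **`descent_step`** — if `λ ∈ C^{p+1}`, `κ ∈ C^p` are smooth and equivariant on `X` with `δλ = 0`,
  `dλ = δκ` on `X` and `δκ` without degree-`0` part, then `λ' = κ - T_ψ(λ, κ)` is smooth and
  equivariant on `X` with `δλ' = 0`, `dλ' = dκ` on `X`;
* **`descent`** — the descent theorem: along a tower `κ_j ∈ C^j` with `dκ_{j+1} = δκ_j` on `X`, every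
  `λ ∈ C^{p+1}` with `δλ = 0`, `dλ = δκ_p` on `X` descends in `p + 1` steps to an invariant `β ∈ C^0`
  (`δβ = 0`) with `dβ = dκ₀` on `X` — the collating formula of the Čech–de Rham double complex for a
  discrete group acting on a convex set, with explicit operators (so that growth propagates).
  [cite: BottTu1982Forms, §II.9] [cite: Dupont1976, §1–2]

## References

* R. Bott, L. W. Tu, *Differential Forms in Algebraic Topology*, GTM 82 (1982), §II.8–9. [BottTu1982Forms]
* J. L. Dupont, Topology 15 (1976), §1–2. [Dupont1976]
-/

noncomputable section

open CategoryTheory Set MeasureTheory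
open Literature.Analysis.Calculus Literature.Geometry.Kaehler

namespace Literature.NumberTheory.Automorphic

namespace TwistedQuotient

variable {Γ 𝒢 : Type} [Group Γ] [Group 𝒢] (ι : Γ →* 𝒢) (L : Subgroup 𝒢)
  {V : Type} [NormedAddCommGroup V] [NormedSpace ℂ V]
  (ρ : Representation ℂ Γ V)
  {W : Type} [NormedAddCommGroup W] [NormedSpace ℝ W]
  (a : Γ →* (W →L[ℝ] W))

section ActionSub

variable [FiniteDimensional ℂ V]

/-- `famAct` respects differences. [folklore] -/
theorem famAct_sub (γ : Γ) (α β : TFam L W V) :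
    famAct ι L ρ a γ (α - β) = famAct ι L ρ a γ α - famAct ι L ρ a γ β := by
  funext c r x
  ext v
  simp [famAct_apply]

end ActionSub

section Step

open Filter Topology
open scoped ContDiff Topology

variable [FiniteDimensional ℂ V]
variable {X : Set W} {ψ : W → ℝ}

omit [Group Γ] [FiniteDimensional ℂ V] in
/-- `δ` of a difference. [folklore] -/
theorem delta_sub {p : ℕ} (φ φ' : Coch Γ L W V p) : delta L (φ - φ') = delta L φ - delta L φ' := by
  funext g
  simp only [delta_apply, Pi.sub_apply, smul_sub, Finset.sum_sub_distrib]

omit [FiniteDimensional ℂ V] in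
/-- `d` of a difference of families at a point of differentiability. [folklore] -/
theorem famD_sub_apply (α β : TFam L W V) (c : 𝒢 ⧸ L) (r : ℕ) {x : W}
    (hα : DifferentiableAt ℝ (α c r) x) (hβ : DifferentiableAt ℝ (β c r) x) :
    famD L (α - β) c (r + 1) x = famD L α c (r + 1) x - famD L β c (r + 1) x := by
  simp only [famD_succ, Pi.sub_apply]
  rw [sub_eq_add_neg, sub_eq_add_neg, ← neg_one_smul ℝ (β c r), ← neg_one_smul ℝ (extDeriv (β c r) x),
    ← extDeriv_smul, ← extDeriv_add hα ((hβ.const_smul (-1 : ℝ)))]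

omit [Group Γ] [FiniteDimensional ℂ V] in
/-- **`d δ = δ d` at smooth points** (`d` of a finite signed sum). [folklore] -/
theorem cochD_delta_apply {p : ℕ} (φ : Coch Γ L W V p) (g : Fin (p + 2) → Γ) (c : 𝒢 ⧸ L) (r : ℕ)
    {x : W} (hφ : ∀ i : Fin (p + 2), DifferentiableAt ℝ (φ (fun j => g (i.succAbove j)) c r) x) :
    cochD L (delta L φ) g c (r + 1) x = delta L (cochD L φ) g c (r + 1) x := by
  rw [cochD_apply, famD_succ, delta_apply]
  have h : (∑ i : Fin (p + 2), ((-1 : ℝ) ^ (i : ℕ)) • φ (fun j => g (i.succAbove j))) c r =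
      fun y => ∑ i : Fin (p + 2), (((-1 : ℝ) ^ (i : ℕ)) • φ (fun j => g (i.succAbove j)) c r) y := by
    funext y
    simp only [Finset.sum_apply, Pi.smul_apply]
  rw [h, extDeriv_finset_sum Finset.univ fun i _ => (hφ i).const_smul _, delta_apply]
  simp only [Finset.sum_apply, Pi.smul_apply, cochD_apply, famD_succ]
  refine Finset.sum_congr rfl fun i _ => ?_
  exact extDeriv_smul ((-1 : ℝ) ^ (i : ℕ)) (φ (fun j => g (i.succAbove j)) c r)

omit [Group Γ] [FiniteDimensional ℂ V] in
/-- In degree `0`, `d` vanishes by definition, so `d δ = δ d` there too. [folklore] -/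
theorem cochD_delta_zero {p : ℕ} (φ : Coch Γ L W V p) (g : Fin (p + 2) → Γ) (c : 𝒢 ⧸ L) (x : W) :
    cochD L (delta L φ) g c 0 x = delta L (cochD L φ) g c 0 x := by
  simp [cochD_apply, delta_apply, Finset.sum_apply]

/-! ### Equivariance on `X` is preserved by the operators -/

/-- `δ` preserves equivariance on `X`. [folklore] -/
theorem isEquivariantOn_delta {p : ℕ} {φ : Coch Γ L W V p} (hφ : IsEquivariantOn ι L ρ (a := a) X φ) :
    IsEquivariantOn ι L ρ (a := a) X (delta L φ) := by
  intro γ g c r x hx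
  simp only [delta_apply, Finset.sum_apply, Pi.smul_apply, famAct_sum, famAct_smul]
  refine Finset.sum_congr rfl fun i _ => ?_
  rw [← hφ γ _ c r x hx]

/-- Differences preserve equivariance on `X`. [folklore] -/
theorem isEquivariantOn_sub {p : ℕ} {φ φ' : Coch Γ L W V p} (hφ : IsEquivariantOn ι L ρ (a := a) X φ)
    (hφ' : IsEquivariantOn ι L ρ (a := a) X φ') : IsEquivariantOn ι L ρ (a := a) X (φ - φ') := by
  intro γ g c r x hx
  have h1 := hφ γ g c r x hx
  have h2 := hφ' γ g c r x hx
  simp only [Pi.sub_apply] at *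
  rw [h1, h2, famAct_sub]
  rfl

/-- `S_ψ` preserves equivariance on a `Γ`-stable `X`. [cite: Dupont1976, §1–2] -/
theorem isEquivariantOn_cochS (ψ : W → ℝ) {p : ℕ}
    {φ : Coch Γ L W V (p + 1)} (hφ : IsEquivariantOn ι L ρ (a := a) X φ) :
    IsEquivariantOn ι L ρ (a := a) X (cochS L a ψ φ) := by
  intro δ g c r x hx
  rw [cochS_apply, famAct_eq_actAlt, cochS_apply, AddEquiv.map_finsum]
  rw [← finsum_comp (Equiv.mulLeft δ) (Equiv.bijective _)]
  refine finsum_congr fun γ => ?_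
  have hγ : φ (Fin.cons (δ * γ) fun i => δ * g i) c r x = famAct ι L ρ a δ (φ (Fin.cons γ g)) c r x := by
    rw [← mul_cons, hφ δ _ c r x hx]
  rw [Equiv.coe_mulLeft, hγ, famAct_eq_actAlt, actAlt_smul, psi_mul_inv a ψ δ γ x]

/-- `d` preserves equivariance on a `Γ`-stable open `X` for cochains smooth on `X`. [folklore] -/
theorem isEquivariantOn_cochD (hXo : IsOpen X) (hmaps : ∀ γ : Γ, MapsTo (a γ) X X) {p : ℕ}
    {φ : Coch Γ L W V p} (hφ : IsEquivariantOn ι L ρ (a := a) X φ) (hφs : SmoothOn L X φ) :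
    IsEquivariantOn ι L ρ (a := a) X (cochD L φ) := by
  intro γ g c r x hx
  cases r with
  | zero =>
    rw [cochD_apply, cochD_apply, famD_zero]
    ext v
    simp [famAct_apply]
  | succ r =>
    rw [cochD_apply, cochD_apply]
    have hdiff : DifferentiableAt ℝ (φ g ((ι γ)⁻¹ • c) r) (a γ⁻¹ x) :=
      ((hφs g _ r).contDiffAt (hXo.mem_nhds (hmaps γ⁻¹ hx))).differentiableAt (by simp)
    rw [← famD_famAct_apply ι L ρ (a := a) γ (φ g) c r hdiff, famD_succ, famD_succ]
    -- the two families agree near `x` (on the open `X`)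
    refine Filter.EventuallyEq.extDeriv_eq ?_
    filter_upwards [hXo.mem_nhds hx] with y hy
    exact hφ γ g c r y hy

/-! ### Smoothness on `X` is preserved by the operators -/

omit [Group Γ] [FiniteDimensional ℂ V] in
/-- `δ` preserves smoothness on `X`. [folklore] -/
theorem smoothOn_delta {p : ℕ} {φ : Coch Γ L W V p} (hφ : SmoothOn L X φ) : SmoothOn L X (delta L φ) := by
  intro g c r
  have h : (delta L φ g c r) = fun y => ∑ i : Fin (p + 2), ((-1 : ℝ) ^ (i : ℕ)) • φ (fun j => g (i.succAbove j)) c r y := by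
    funext y
    simp only [delta_apply, Finset.sum_apply, Pi.smul_apply]
  rw [h]
  exact ContDiffOn.sum fun i _ => (hφ _ c r).const_smul _

omit [Group Γ] [FiniteDimensional ℂ V] in
/-- Differences preserve smoothness on `X`. [folklore] -/
theorem smoothOn_sub {p : ℕ} {φ φ' : Coch Γ L W V p} (hφ : SmoothOn L X φ) (hφ' : SmoothOn L X φ') :
    SmoothOn L X (φ - φ') :=
  fun g c r => (hφ g c r).sub (hφ' g c r)

omit [Group Γ] [FiniteDimensional ℂ V] in
/-- `d` preserves smoothness on an open `X`. [folklore] -/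
theorem smoothOn_cochD (hXo : IsOpen X) {p : ℕ} {φ : Coch Γ L W V p} (hφ : SmoothOn L X φ) :
    SmoothOn L X (cochD L φ) := by
  intro g c r
  cases r with
  | zero =>
    rw [cochD_apply, famD_zero]
    exact contDiffOn_const
  | succ r =>
    rw [cochD_apply, famD_succ]
    have h1 : ContDiffOn ℝ ∞ (fderiv ℝ (φ g c r)) X := (hφ g c r).fderiv_of_isOpen hXo (by simp)
    exact (ContinuousAlternatingMap.alternatizeUncurryFinCLM ℝ W V).contDiff.comp_contDiffOn h1

omit [FiniteDimensional ℂ V] in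
/-- `T_ψ(λ, κ)` is smooth on `X` (it is `d(S_ψ λ)` there). [folklore] -/
theorem smoothOn_cochT (hψ : IsPOU (Γ := Γ) a X ψ) (hXo : IsOpen X) (hmaps : ∀ γ : Γ, MapsTo (a γ) X X)
    {p : ℕ} {lam : Coch Γ L W V (p + 1)} {κ : Coch Γ L W V p} (hlam : SmoothOn L X lam)
    (hd : ∀ (g : Fin (p + 2) → Γ) (c : 𝒢 ⧸ L) (r : ℕ), ∀ x ∈ X, cochD L lam g c r x = delta L κ g c r x)
    (hκ0 : ∀ (g : Fin (p + 2) → Γ) (c : 𝒢 ⧸ L), ∀ x ∈ X, delta L κ g c 0 x = 0) :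
    SmoothOn L X (cochT L a ψ lam κ) := by
  intro g c r
  refine (smoothOn_cochD L hXo (hlam.cochS L hψ hXo hmaps) g c r).congr fun x hx => ?_
  exact cochT_eq_cochD_cochS_apply L hψ hXo hmaps hlam hd hκ0 g c r hx

omit [FiniteDimensional ℂ V] in
/-- **`d T_ψ(λ, κ) = 0` on `X`** (it is `dd(S_ψ λ)` there). [cite: BottTu1982Forms, §II.9] -/
theorem cochD_cochT_apply (hψ : IsPOU (Γ := Γ) a X ψ) (hXo : IsOpen X) (hmaps : ∀ γ : Γ, MapsTo (a γ) X X)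
    {p : ℕ} {lam : Coch Γ L W V (p + 1)} {κ : Coch Γ L W V p} (hlam : SmoothOn L X lam)
    (hd : ∀ (g : Fin (p + 2) → Γ) (c : 𝒢 ⧸ L) (r : ℕ), ∀ x ∈ X, cochD L lam g c r x = delta L κ g c r x)
    (hκ0 : ∀ (g : Fin (p + 2) → Γ) (c : 𝒢 ⧸ L), ∀ x ∈ X, delta L κ g c 0 x = 0)
    (g : Fin (p + 1) → Γ) (c : 𝒢 ⧸ L) (r : ℕ) {x : W} (hx : x ∈ X) :
    cochD L (cochT L a ψ lam κ) g c r x = 0 := by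
  cases r with
  | zero => simp [cochD_apply]
  | succ r =>
    rw [cochD_apply, famD_succ]
    have heq : cochT L a ψ lam κ g c r =ᶠ[𝓝 x] cochD L (cochS L a ψ lam) g c r := by
      filter_upwards [hXo.mem_nhds hx] with y hy
      exact cochT_eq_cochD_cochS_apply L hψ hXo hmaps hlam hd hκ0 g c r hy
    rw [heq.extDeriv_eq]
    cases r with
    | zero =>
      have h0 : cochD L (cochS L a ψ lam) g c 0 = fun _ => 0 := by funext y; simp [cochD_apply]
      rw [h0]
      simp [extDeriv]
      exact map_zero (ContinuousAlternatingMap.alternatizeUncurryFinCLM ℝ W V)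
    | succ r =>
      rw [cochD_apply, famD_succ]
      exact extDeriv_extDeriv_apply (((hlam.cochS L hψ hXo hmaps) g c r).contDiffAt (hXo.mem_nhds hx))
        (by rw [minSmoothness_of_isRCLikeNormedField]; exact WithTop.coe_le_coe.2 le_top)

/-! ### The descent step and the descent theorem -/

/-- **The descent step.**  If `λ ∈ C^{p+1}` and `κ ∈ C^p` are smooth and equivariant on `X`, `δλ = 0`
and `dλ = δκ` on `X`, and `δκ` has no degree-`0` part on `X`, then `λ' = κ - T_ψ(λ, κ) ∈ C^p` is
smooth and equivariant on `X` with `δλ' = 0` and `dλ' = dκ` on `X`. [cite: BottTu1982Forms, §II.9] -/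
theorem descent_step (hψ : IsPOU (Γ := Γ) a X ψ) (hXo : IsOpen X) (hmaps : ∀ γ : Γ, MapsTo (a γ) X X)
    {p : ℕ} {lam : Coch Γ L W V (p + 1)} {κ : Coch Γ L W V p}
    (hlamS : SmoothOn L X lam) (hκS : SmoothOn L X κ)
    (hlamE : IsEquivariantOn ι L ρ (a := a) X lam) (hκE : IsEquivariantOn ι L ρ (a := a) X κ)
    (hδlam : ∀ (g : Fin (p + 3) → Γ) (c : 𝒢 ⧸ L) (r : ℕ), ∀ x ∈ X, delta L lam g c r x = 0)
    (hd : ∀ (g : Fin (p + 2) → Γ) (c : 𝒢 ⧸ L) (r : ℕ), ∀ x ∈ X, cochD L lam g c r x = delta L κ g c r x)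
    (hκ0 : ∀ (g : Fin (p + 2) → Γ) (c : 𝒢 ⧸ L), ∀ x ∈ X, delta L κ g c 0 x = 0) :
    SmoothOn L X (κ - cochT L a ψ lam κ) ∧ IsEquivariantOn ι L ρ (a := a) X (κ - cochT L a ψ lam κ) ∧
      (∀ (g : Fin (p + 2) → Γ) (c : 𝒢 ⧸ L) (r : ℕ), ∀ x ∈ X, delta L (κ - cochT L a ψ lam κ) g c r x = 0) ∧
        ∀ (g : Fin (p + 1) → Γ) (c : 𝒢 ⧸ L) (r : ℕ), ∀ x ∈ X,
          cochD L (κ - cochT L a ψ lam κ) g c r x = cochD L κ g c r x := by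
  have hTS : SmoothOn L X (cochT L a ψ lam κ) := smoothOn_cochT L a hψ hXo hmaps hlamS hd hκ0
  have hTE : IsEquivariantOn ι L ρ (a := a) X (cochT L a ψ lam κ) := by
    -- `T = d(Sλ)` on `X`, and `d`, `S` preserve equivariance on `X`
    intro γ g c r x hx
    have hSE := isEquivariantOn_cochD ι L ρ a hXo hmaps (isEquivariantOn_cochS ι L ρ a ψ hlamE) (hlamS.cochS L hψ hXo hmaps)
    rw [cochT_eq_cochD_cochS_apply L hψ hXo hmaps hlamS hd hκ0 _ c r hx, hSE γ g c r x hx]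
    -- both sides are the action applied to families that agree at the relevant point of `X`
    rw [famAct_eq_actAlt, famAct_eq_actAlt,
      cochT_eq_cochD_cochS_apply L hψ hXo hmaps hlamS hd hκ0 g _ r (hmaps γ⁻¹ hx)]
  refine ⟨smoothOn_sub L hκS hTS, isEquivariantOn_sub ι L ρ a hκE hTE, fun g c r x hx => ?_, fun g c r x hx => ?_⟩
  · rw [delta_sub, Pi.sub_apply, Pi.sub_apply, Pi.sub_apply, Pi.sub_apply,
      delta_cochT_apply L hψ hXo hmaps lam κ hδlam g c r hx, sub_self]
  · cases r with
    | zero => simp [cochD_apply]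
    | succ r =>
      rw [cochD_apply, cochD_apply]
      change famD L (κ g - cochT L a ψ lam κ g) c (r + 1) x = _
      rw [famD_sub_apply L (κ g) (cochT L a ψ lam κ g) c r
          (((hκS g c r).contDiffAt (hXo.mem_nhds hx)).differentiableAt (by simp))
          (((hTS g c r).contDiffAt (hXo.mem_nhds hx)).differentiableAt (by simp))]
      have h0 := cochD_cochT_apply L a hψ hXo hmaps hlamS hd hκ0 g c (r + 1) hx
      rw [cochD_apply] at h0
      rw [h0, sub_zero]

/-- **The descent theorem.**  Let `κ : (j : ℕ) → C^j` be a tower of cochains, smooth and equivariant on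
`X`, with `dκ_{j+1} = δκ_j` on `X` for `j < p` and no degree-`0` parts on `X` up to level `p`.  Then
every `λ ∈ C^{p+1}`, smooth and equivariant on `X` with `δλ = 0` and `dλ = δκ_p` on `X`, descends to a
`β ∈ C^0`, smooth and equivariant on `X`, with `δβ = 0` (invariance) and `dβ = dκ₀` on `X` — by `p + 1`
descent steps. [cite: BottTu1982Forms, §II.9 (the collating formula)] [cite: Dupont1976, §1–2] -/
theorem descent (hψ : IsPOU (Γ := Γ) a X ψ) (hXo : IsOpen X) (hmaps : ∀ γ : Γ, MapsTo (a γ) X X)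
    (κ : (j : ℕ) → Coch Γ L W V j) :
    ∀ p : ℕ, (∀ j ≤ p, SmoothOn L X (κ j)) → (∀ j ≤ p, IsEquivariantOn ι L ρ (a := a) X (κ j)) →
      (∀ j < p, ∀ (g : Fin (j + 2) → Γ) (c : 𝒢 ⧸ L) (r : ℕ), ∀ x ∈ X,
        cochD L (κ (j + 1)) g c r x = delta L (κ j) g c r x) →
      (∀ j ≤ p, ∀ (g : Fin (j + 2) → Γ) (c : 𝒢 ⧸ L), ∀ x ∈ X, delta L (κ j) g c 0 x = 0) →
      ∀ lam : Coch Γ L W V (p + 1), SmoothOn L X lam → IsEquivariantOn ι L ρ (a := a) X lam →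
        (∀ (g : Fin (p + 3) → Γ) (c : 𝒢 ⧸ L) (r : ℕ), ∀ x ∈ X, delta L lam g c r x = 0) →
        (∀ (g : Fin (p + 2) → Γ) (c : 𝒢 ⧸ L) (r : ℕ), ∀ x ∈ X, cochD L lam g c r x = delta L (κ p) g c r x) →
        ∃ β : Coch Γ L W V 0, SmoothOn L X β ∧ IsEquivariantOn ι L ρ (a := a) X β ∧
          (∀ (g : Fin 2 → Γ) (c : 𝒢 ⧸ L) (r : ℕ), ∀ x ∈ X, delta L β g c r x = 0) ∧
          ∀ (g : Fin 1 → Γ) (c : 𝒢 ⧸ L) (r : ℕ), ∀ x ∈ X, cochD L β g c r x = cochD L (κ 0) g c r x := by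
  intro p
  induction p with
  | zero =>
    intro hS hE _ h0 lam hlamS hlamE hδ hd
    obtain ⟨h1, h2, h3, h4⟩ := descent_step ι L ρ a hψ hXo hmaps hlamS (hS 0 le_rfl) hlamE (hE 0 le_rfl) hδ hd (h0 0 le_rfl)
    exact ⟨_, h1, h2, h3, h4⟩
  | succ p ih =>
    intro hS hE htower h0 lam hlamS hlamE hδ hd
    obtain ⟨h1, h2, h3, h4⟩ := descent_step ι L ρ a hψ hXo hmaps hlamS (hS (p + 1) le_rfl) hlamE (hE (p + 1) le_rfl)
      hδ hd (h0 (p + 1) le_rfl)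
    refine ih (fun j hj => hS j (Nat.le_succ_of_le hj)) (fun j hj => hE j (Nat.le_succ_of_le hj))
      (fun j hj => htower j (Nat.lt_succ_of_lt hj)) (fun j hj => h0 j (Nat.le_succ_of_le hj)) _ h1 h2 h3 ?_
    intro g c r x hx
    rw [h4 g c r x hx]
    exact htower p (Nat.lt_succ_self p) g c r x hx

end Step

end TwistedQuotient

end Literature.NumberTheory.Automorphic

end
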